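import Summits.CriticalPhenomena.Ising3DConformalLimit.Theorems.HyperoctahedralRPExistsScaleCovariantLimitBlockDefs
import Literature.Probability.LatticeModels.PointwiseScalingLimitEtaExists
import HarnessLib

/-!
# Block covariance versus the axial two-point function
(line `monotone-blocking-port` of crux `ExistsScaleCovariantLimit`, stmt-CriticalPhenomena-1981;
stub `stub_blockCovTwoPointBounds`, S4b)

With `g(m) = ⟨σ₀σ_{m e₁}⟩_{β_c}` the axial critical two-point function of the n.n. Ising model on `ℤ³`,
`C(L; k) = blockCov L k = Σ_{x,y ∈ cube L} ⟨σ₀σ_{y-x+Lk}⟩_{β_c}` and `V(L) = C(L; 0)`: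

1. SANDWICH: `L⁶ g((j+3)L) ≤ C(L; j e₁) ≤ L⁶ g((j-1)L)` for `j ≥ 1`. Pointwise, for `z = y - x + jL e₁`
   with `x, y ∈ cube L`: `g(‖z‖₁) ≤ ⟨σ₀σ_z⟩ ≤ g(‖z‖_∞)` — the upper half is the tree's MMS sphere bound
   `criticalTwoPoint_axis_sandwich`, the lower half is the `ℓ¹` form of Messager–Miracle-Solé
   (reflect into the positive orthant `twoPointPlus_abs_eq`, collapse the mass onto a maximal coordinate
   `twoPointPlus_single_sum_le`, transpose `twoPointPlus_single_eq_single`) — and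
   `‖z‖_∞ ≥ z₁ > (j-1)L`, `‖z‖₁ ≤ (j+3)L`; then `criticalTwoPoint_axis_antitone` and `|cube L|² = L⁶`.
2. TOP-HEAVY SCALES: for `p ≥ 1`, `ε V(L) ≤ L⁶ g(pL)` for infinitely many `L`, `ε = 1/(250 p³)`.
   Otherwise, with `S(R) = Σ_{‖z‖_∞ ≤ R} ⟨σ₀σ_z⟩`: `V(L) ≤ L³ S(L) ≤ L³ S(pL)` and the shell bound
   `S(2M) - S(M) ≤ (4M+1)³ g(M) ≤ 125 M³ g(M)` give `S(2pL) ≤ (3/2) S(pL)` for all large `L`, hence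
   `S(p 2^k L₁) ≤ (3/2)^k S(p L₁)`, against the linear growth `S(R) ≥ c R` that follows from the
   infrared/Simon–Lieb lower bound `⟨σ₀σ_z⟩ ≥ c ‖z‖_∞⁻²` (`criticalTwoPoint_bounds_holds`).

Sources: A. Messager, S. Miracle-Solé, J. Stat. Phys. 17 (1977) 245; H. Duminil-Copin, *Lectures on the
Ising and Potts models on the hypercubic lattice* (2019) §4.3 eq. (4.10), Thm. 4.8;
M. Aizenman, H. Duminil-Copin, Ann. Math. 194 (2021) §5.1.
-/

noncomputable section

namespace Summit.CriticalPhenomena.Ising3DConformalLimit.Cruxes.ExistsScaleCovariantLimit.MonotoneBlockingPort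

open Literature.Probability.LatticeModels Filter
open scoped Topology BigOperators

/-! ## The `ℓ¹` / `ℓ^∞` comparison with the axis -/

/-- `ℓ¹` form of Messager–Miracle-Solé on `ℤ³`: `⟨σ₀σ_{(Σᵢ|yᵢ|) e₁}⟩⁺_β ≤ ⟨σ₀σ_y⟩⁺_β` (reflect into the
positive orthant, collapse the mass onto a maximal coordinate by diagonal moves, transpose).
[cite: DuminilCopin2019, Exercise 37 (4), §4.3] -/
private theorem twoPointPlus_single_l1_le {β : ℝ} (hβ : 0 ≤ β) (y : Site 3) :
    twoPointPlus 3 β (Pi.single 0 (∑ i, |y i|)) ≤ twoPointPlus 3 β y := by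
  obtain ⟨i₀, hi₀⟩ := Site.exists_natAbs_eq_supNorm ⟨0, Finset.mem_univ _⟩ y
  set z : Site 3 := fun i => |y i| with hz
  have hz0 : ∀ i, 0 ≤ z i := fun i => abs_nonneg _
  have hzle : ∀ i, z i ≤ z i₀ := fun i => by
    have h := Site.natAbs_le_supNorm y i
    rw [← hi₀] at h
    simp only [hz, Int.abs_eq_natAbs]
    exact_mod_cast h
  rw [← twoPointPlus_abs_eq twoPointPlus_reflection_invariant_holds hβ y,
    twoPointPlus_single_eq_single twoPointPlus_perm_invariant_holds hβ 0 i₀]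
  change twoPointPlus 3 β (Pi.single i₀ (∑ i, z i)) ≤ twoPointPlus 3 β z
  exact twoPointPlus_single_sum_le messager_miracleSole_diag_holds hβ i₀
    (∑ j ∈ Finset.univ.erase i₀, z j).toNat z (fun j _ => ⟨hz0 j, hzle j⟩)
    (by rw [Int.toNat_of_nonneg (Finset.sum_nonneg fun j _ => hz0 j)])

/-- `g(N) ≤ ⟨σ₀σ_z⟩_{β_c}` whenever `‖z‖₁ ≤ N` (`ℓ¹` MMS bound and axis antitonicity). [folklore] -/
private theorem axis_le_of_l1_le {z : Site 3} {N : ℕ} (hN : ∑ i, |z i| ≤ (N : ℤ)) :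
    criticalTwoPoint 3 (Pi.single 0 (N : ℤ)) ≤ criticalTwoPoint 3 z := by
  have h0 : 0 ≤ ∑ i, |z i| := Finset.sum_nonneg fun i _ => abs_nonneg _
  have hle : (∑ i, |z i|).toNat ≤ N := by omega
  have h1 : criticalTwoPoint 3 (Pi.single 0 (N : ℤ)) ≤
      criticalTwoPoint 3 (Pi.single 0 (((∑ i, |z i|).toNat : ℕ) : ℤ)) :=
    criticalTwoPoint_axis_antitone hle
  rw [Int.toNat_of_nonneg h0] at h1
  exact h1.trans (twoPointPlus_single_l1_le (criticalBeta_nonneg 3) z)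

/-- `⟨σ₀σ_z⟩_{β_c} ≤ g(N)` whenever `1 ≤ ‖z‖_∞` and `N ≤ ‖z‖_∞` (MMS sphere bound and axis
antitonicity). [folklore] -/
private theorem le_axis_of_le_supNorm {z : Site 3} {N : ℕ} (h1 : 1 ≤ Site.supNorm z)
    (hN : N ≤ Site.supNorm z) :
    criticalTwoPoint 3 z ≤ criticalTwoPoint 3 (Pi.single 0 (N : ℤ)) :=
  (criticalTwoPoint_axis_sandwich h1).2.trans (criticalTwoPoint_axis_antitone hN)

/-! ## Part 1: the sandwich `L⁶ g((j+3)L) ≤ C(L; j e₁) ≤ L⁶ g((j-1)L)` -/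

/-- Geometry of `z = y - x + jL e₁` for `x, y ∈ cube L`, `j ≥ 1`: `‖z‖_∞ ≥ 1`, `‖z‖_∞ ≥ (j-1)L`,
`‖z‖₁ ≤ (j+3)L`. [folklore] -/
private theorem geom {j L : ℕ} (hj : 1 ≤ j) {x y : Site 3} (hx : x ∈ cube L) (hy : y ∈ cube L) :
    1 ≤ Site.supNorm (y - x + (L : ℤ) • (Pi.single 0 (j : ℤ) : Site 3)) ∧
      (j - 1) * L ≤ Site.supNorm (y - x + (L : ℤ) • (Pi.single 0 (j : ℤ) : Site 3)) ∧
      ∑ i, |(y - x + (L : ℤ) • (Pi.single 0 (j : ℤ) : Site 3)) i| ≤ (((j + 3) * L : ℕ) : ℤ) := by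
  rw [mem_cube] at hx hy
  obtain ⟨hx0, hx0'⟩ := hx 0
  obtain ⟨hx1, hx1'⟩ := hx 1
  obtain ⟨hx2, hx2'⟩ := hx 2
  obtain ⟨hy0, hy0'⟩ := hy 0
  obtain ⟨hy1, hy1'⟩ := hy 1
  obtain ⟨hy2, hy2'⟩ := hy 2
  have hz0 : (y - x + (L : ℤ) • (Pi.single 0 (j : ℤ) : Site 3)) 0 = y 0 - x 0 + (L : ℤ) * j := by
    simp
  have hz1 : (y - x + (L : ℤ) • (Pi.single 0 (j : ℤ) : Site 3)) 1 = y 1 - x 1 := by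
    simp
  have hz2 : (y - x + (L : ℤ) • (Pi.single 0 (j : ℤ) : Site 3)) 2 = y 2 - x 2 := by
    simp
  obtain ⟨P, hP'⟩ : ∃ P : ℕ, (j - 1) * L = P := ⟨_, rfl⟩
  obtain ⟨Q, hQ'⟩ : ∃ Q : ℕ, (j + 3) * L = Q := ⟨_, rfl⟩
  have hP : (P : ℤ) = (L : ℤ) * j - L := by
    rw [← hP', Nat.cast_mul, Nat.cast_sub hj, Nat.cast_one]; ring
  have hQ : (Q : ℤ) = (L : ℤ) * j + 3 * L := by
    rw [← hQ']; push_cast; ring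
  have hLj : (L : ℤ) ≤ (L : ℤ) * j := le_mul_of_one_le_right (by positivity) (by exact_mod_cast hj)
  obtain ⟨A, hA⟩ : ∃ A : ℤ, (L : ℤ) * j = A := ⟨_, rfl⟩
  rw [hA] at hz0 hP hQ hLj
  rw [hP', hQ']
  have hn := Site.natAbs_le_supNorm (y - x + (L : ℤ) • (Pi.single 0 (j : ℤ) : Site 3)) 0
  refine ⟨by omega, by omega, ?_⟩
  simp only [Fin.sum_univ_three, Int.abs_eq_natAbs]
  omega

/-- `Σ_{x,y ∈ cube L} c = L⁶ c`. [folklore] -/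
private theorem sum_const_cube (L : ℕ) (c : ℝ) :
    ∑ _x ∈ cube L, ∑ _y ∈ cube L, c = (L : ℝ) ^ 6 * c := by
  simp only [Finset.sum_const, card_cube, nsmul_eq_mul, Nat.cast_pow]
  ring

/-- The sandwich `L⁶ g((j+3)L) ≤ C(L; j e₁) ≤ L⁶ g((j-1)L)`, `j ≥ 1`. [cite: MessagerMiracleSoleJSP1977, main theorem (monotonicity of ⟨σ₀σ_x⟩ under reflections)] -/
private theorem sandwich (j L : ℕ) (hj : 1 ≤ j) :
    (L : ℝ) ^ 6 * criticalTwoPoint 3 (Pi.single 0 (((j + 3) * L : ℕ) : ℤ)) ≤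
        blockCov L (Pi.single 0 (j : ℤ)) ∧
      blockCov L (Pi.single 0 (j : ℤ)) ≤
        (L : ℝ) ^ 6 * criticalTwoPoint 3 (Pi.single 0 (((j - 1) * L : ℕ) : ℤ)) := by
  unfold blockCov
  constructor
  · calc (L : ℝ) ^ 6 * criticalTwoPoint 3 (Pi.single 0 (((j + 3) * L : ℕ) : ℤ))
        = ∑ _x ∈ cube L, ∑ _y ∈ cube L, criticalTwoPoint 3 (Pi.single 0 (((j + 3) * L : ℕ) : ℤ)) :=
          (sum_const_cube L _).symm
      _ ≤ _ := Finset.sum_le_sum fun x hx => Finset.sum_le_sum fun y hy =>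
          axis_le_of_l1_le (geom hj hx hy).2.2
  · calc ∑ x ∈ cube L, ∑ y ∈ cube L, criticalTwoPoint 3 (y - x + (L : ℤ) • (Pi.single 0 (j : ℤ) : Site 3))
        ≤ ∑ _x ∈ cube L, ∑ _y ∈ cube L, criticalTwoPoint 3 (Pi.single 0 (((j - 1) * L : ℕ) : ℤ)) :=
          Finset.sum_le_sum fun x hx => Finset.sum_le_sum fun y hy =>
            le_axis_of_le_supNorm (geom hj hx hy).1 (geom hj hx hy).2.1
      _ = _ := sum_const_cube L _

/-! ## Part 2: top-heavy scales -/

/-- `S(R) = Σ_{‖z‖_∞ ≤ R} ⟨σ₀σ_z⟩_{β_c}` is monotone in `R` (Griffiths: the terms are `≥ 0`). [folklore] -/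
private theorem boxSum_mono {R R' : ℕ} (h : R ≤ R') :
    ∑ z ∈ box 3 R, criticalTwoPoint 3 z ≤ ∑ z ∈ box 3 R', criticalTwoPoint 3 z :=
  Finset.sum_le_sum_of_subset_of_nonneg (box_mono 3 h) fun z _ _ => criticalTwoPoint_nonneg' z

/-- `V(L) ≤ L³ S(L)`: each row `Σ_{y ∈ cube L} ⟨σ_xσ_y⟩` is a sum over distinct sites of `Λ_L`.
[folklore] -/
private theorem blockCov_le_boxSum (L : ℕ) :
    blockCov L 0 ≤ (L : ℝ) ^ 3 * ∑ z ∈ box 3 L, criticalTwoPoint 3 z := by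
  rw [blockCov_zero_eq]
  have hrow : ∀ x ∈ cube L,
      ∑ y ∈ cube L, criticalTwoPoint 3 (y - x) ≤ ∑ z ∈ box 3 L, criticalTwoPoint 3 z := by
    intro x hx
    have hsub : (cube L).image (fun y => y - x) ⊆ box 3 L := by
      intro z hz
      rw [Finset.mem_image] at hz
      obtain ⟨y, hy, rfl⟩ := hz
      rw [mem_cube] at hx hy
      rw [mem_box]
      intro i
      obtain ⟨h1, h2⟩ := hx i
      obtain ⟨h3, h4⟩ := hy i
      simp only [Pi.sub_apply]
      constructor <;> omega
    calc ∑ y ∈ cube L, criticalTwoPoint 3 (y - x)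
        = ∑ z ∈ (cube L).image (fun y => y - x), criticalTwoPoint 3 z :=
          (Finset.sum_image fun a _ b _ h => sub_left_injective h).symm
      _ ≤ ∑ z ∈ box 3 L, criticalTwoPoint 3 z :=
          Finset.sum_le_sum_of_subset_of_nonneg hsub fun z _ _ => criticalTwoPoint_nonneg' z
  calc ∑ x ∈ cube L, ∑ y ∈ cube L, criticalTwoPoint 3 (y - x)
      ≤ ∑ _x ∈ cube L, ∑ z ∈ box 3 L, criticalTwoPoint 3 z := Finset.sum_le_sum hrow
    _ = (L : ℝ) ^ 3 * ∑ z ∈ box 3 L, criticalTwoPoint 3 z := by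
      rw [Finset.sum_const, card_cube, nsmul_eq_mul, Nat.cast_pow]

/-- SHELL BOUND: `S(2M) ≤ S(M) + 125 M³ g(M)` for `M ≥ 1` (every `z ∈ Λ_{2M} ∖ Λ_M` has
`⟨σ₀σ_z⟩ ≤ g(‖z‖_∞) ≤ g(M)`, and `|Λ_{2M}| = (4M+1)³ ≤ 125 M³`). [folklore] -/
private theorem shell {M : ℕ} (hM : 1 ≤ M) :
    ∑ z ∈ box 3 (2 * M), criticalTwoPoint 3 z ≤
      ∑ z ∈ box 3 M, criticalTwoPoint 3 z +
        125 * (M : ℝ) ^ 3 * criticalTwoPoint 3 (Pi.single 0 (M : ℤ)) := by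
  have hsub : box 3 M ⊆ box 3 (2 * M) := box_mono 3 (by omega)
  have hg := (criticalTwoPoint_axis_pos M).le
  have hdiff : ∑ z ∈ box 3 (2 * M) \ box 3 M, criticalTwoPoint 3 z ≤
      125 * (M : ℝ) ^ 3 * criticalTwoPoint 3 (Pi.single 0 (M : ℤ)) := by
    calc ∑ z ∈ box 3 (2 * M) \ box 3 M, criticalTwoPoint 3 z
        ≤ ∑ _z ∈ box 3 (2 * M) \ box 3 M, criticalTwoPoint 3 (Pi.single 0 (M : ℤ)) :=
          Finset.sum_le_sum fun z hz => by
            rw [Finset.mem_sdiff, mem_box_iff_supNorm_le, mem_box_iff_supNorm_le] at hz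
            exact le_axis_of_le_supNorm (by omega) (by omega)
      _ = ((box 3 (2 * M) \ box 3 M).card : ℝ) * criticalTwoPoint 3 (Pi.single 0 (M : ℤ)) := by
          rw [Finset.sum_const, nsmul_eq_mul]
      _ ≤ ((box 3 (2 * M)).card : ℝ) * criticalTwoPoint 3 (Pi.single 0 (M : ℤ)) := by
          gcongr
          exact Finset.sdiff_subset
      _ = (4 * (M : ℝ) + 1) ^ 3 * criticalTwoPoint 3 (Pi.single 0 (M : ℤ)) := by
          rw [card_box]
          push_cast
          ring
      _ ≤ 125 * (M : ℝ) ^ 3 * criticalTwoPoint 3 (Pi.single 0 (M : ℤ)) := by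
          refine mul_le_mul_of_nonneg_right ?_ hg
          have hM' : (1 : ℝ) ≤ M := by exact_mod_cast hM
          calc (4 * (M : ℝ) + 1) ^ 3 ≤ (5 * (M : ℝ)) ^ 3 :=
                pow_le_pow_left₀ (by positivity) (by linarith) 3
            _ = 125 * (M : ℝ) ^ 3 := by ring
  rw [← Finset.sum_sdiff hsub]
  linarith

/-- LINEAR GROWTH: `S(R) ≥ c R` for `R ≥ 1`, from the infrared/Simon–Lieb lower bound
`⟨σ₀σ_z⟩_{β_c} ≥ c ‖z‖_∞⁻²` (`criticalTwoPoint_bounds_holds`) on the `(2R+1)³ - 1 ≥ R³` nonzero sites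
of `Λ_R`. [cite: DuminilCopin2019, Thm. 4.8, §4.4] -/
private theorem boxSum_lower : ∃ c : ℝ, 0 < c ∧ ∀ R : ℕ, 1 ≤ R →
    c * R ≤ ∑ z ∈ box 3 R, criticalTwoPoint 3 z := by
  obtain ⟨c, C, hc, hb⟩ := criticalTwoPoint_bounds_holds (d := 3) le_rfl
  refine ⟨c, hc, fun R hR => ?_⟩
  have hR0 : (0 : ℝ) < R := by exact_mod_cast hR
  have hpt : ∀ z ∈ (box 3 R).erase 0, c / (R : ℝ) ^ 2 ≤ criticalTwoPoint 3 z := by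
    intro z hz
    rw [Finset.mem_erase, mem_box_iff_supNorm_le] at hz
    obtain ⟨hz0, hzR⟩ := hz
    have h1 := (hb z hz0).1
    rw [Site.norm_eq_supNorm, show (-(((3 : ℕ) : ℝ) - 1)) = -(2 : ℝ) by norm_num] at h1
    have hn0 : (0 : ℝ) < (Site.supNorm z : ℝ) := by
      have : Site.supNorm z ≠ 0 := fun h => hz0 (Site.supNorm_eq_zero_iff.1 h)
      positivity
    have h2 : (R : ℝ) ^ (-(2 : ℝ)) ≤ (Site.supNorm z : ℝ) ^ (-(2 : ℝ)) :=
      Real.rpow_le_rpow_of_nonpos hn0 (by exact_mod_cast hzR) (by norm_num)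
    calc c / (R : ℝ) ^ 2 = c * (R : ℝ) ^ (-(2 : ℝ)) := by
          rw [Real.rpow_neg hR0.le, Real.rpow_two, div_eq_mul_inv]
      _ ≤ c * (Site.supNorm z : ℝ) ^ (-(2 : ℝ)) := mul_le_mul_of_nonneg_left h2 hc.le
      _ ≤ criticalTwoPoint 3 z := h1
  have hcard : (R : ℝ) ^ 3 ≤ (((box 3 R).erase 0).card : ℝ) := by
    have h := Finset.card_erase_add_one (by simp [mem_box] : (0 : Site 3) ∈ box 3 R)
    rw [card_box] at h
    have h' : (((box 3 R).erase 0).card : ℝ) = (2 * (R : ℝ) + 1) ^ 3 - 1 := by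
      rw [eq_sub_iff_add_eq]
      exact_mod_cast h
    rw [h']
    nlinarith [pow_nonneg hR0.le 2, pow_nonneg hR0.le 3]
  calc c * R = (R : ℝ) ^ 3 * (c / (R : ℝ) ^ 2) := by
        field_simp
    _ ≤ (((box 3 R).erase 0).card : ℝ) * (c / (R : ℝ) ^ 2) :=
        mul_le_mul_of_nonneg_right hcard (by positivity)
    _ = ∑ _z ∈ (box 3 R).erase 0, c / (R : ℝ) ^ 2 := by rw [Finset.sum_const, nsmul_eq_mul]
    _ ≤ ∑ z ∈ (box 3 R).erase 0, criticalTwoPoint 3 z := Finset.sum_le_sum hpt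
    _ ≤ ∑ z ∈ box 3 R, criticalTwoPoint 3 z :=
        Finset.sum_le_sum_of_subset_of_nonneg (Finset.erase_subset _ _)
          fun z _ _ => criticalTwoPoint_nonneg' z

/-- TOP-HEAVY SCALES: for `p ≥ 1`, `ε V(L) ≤ L⁶ g(pL)` for infinitely many `L` (`ε = 1/(250p³)`).
[folklore] -/
private theorem topHeavy (p : ℕ) (hp : 1 ≤ p) : ∃ ε : ℝ, 0 < ε ∧
    ∃ᶠ L : ℕ in atTop, ε * blockCov L 0 ≤
      (L : ℝ) ^ 6 * criticalTwoPoint 3 (Pi.single 0 ((p * L : ℕ) : ℤ)) := by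
  obtain ⟨c, hc, hlow⟩ := boxSum_lower
  obtain ⟨S, hS⟩ : ∃ S : ℕ → ℝ, ∀ R, S R = ∑ z ∈ box 3 R, criticalTwoPoint 3 z := ⟨_, fun _ => rfl⟩
  obtain ⟨g, hg⟩ : ∃ g : ℕ → ℝ, ∀ m, g m = criticalTwoPoint 3 (Pi.single 0 (m : ℤ)) :=
    ⟨_, fun _ => rfl⟩
  have hp0 : 0 < p := hp
  have hpR : (0 : ℝ) < p := by exact_mod_cast hp0
  refine ⟨1 / (250 * (p : ℝ) ^ 3), by positivity, ?_⟩
  by_contra hcon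
  rw [Filter.not_frequently, Filter.eventually_atTop] at hcon
  obtain ⟨L₀, hL₀⟩ := hcon
  obtain ⟨L₁, hL₁0, hL₁1⟩ : ∃ L₁ : ℕ, L₀ ≤ L₁ ∧ 1 ≤ L₁ := ⟨max L₀ 1, le_max_left _ _, le_max_right _ _⟩
  -- one doubling step: `S(2pL) ≤ (3/2) S(pL)` for `L ≥ L₁`
  have key : ∀ L : ℕ, L₁ ≤ L → S (2 * (p * L)) ≤ 3 / 2 * S (p * L) := by
    intro L hL
    have hL1 : 1 ≤ L := le_trans hL₁1 hL
    have hLR : (0 : ℝ) < L := by exact_mod_cast hL1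
    have hnot := hL₀ L (le_trans hL₁0 hL)
    rw [not_le, ← hg] at hnot
    have hV : blockCov L 0 ≤ (L : ℝ) ^ 3 * S (p * L) := by
      rw [hS]
      exact (blockCov_le_boxSum L).trans
        (mul_le_mul_of_nonneg_left (boxSum_mono (Nat.le_mul_of_pos_left L hp0)) (by positivity))
    have hsh : S (2 * (p * L)) ≤ S (p * L) + 125 * ((p * L : ℕ) : ℝ) ^ 3 * g (p * L) := by
      rw [hS, hS, hg]
      exact shell (Nat.mul_pos hp0 hL1)
    have h1 : (L : ℝ) ^ 6 * g (p * L) < 1 / (250 * (p : ℝ) ^ 3) * ((L : ℝ) ^ 3 * S (p * L)) :=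
      hnot.trans_le (mul_le_mul_of_nonneg_left hV (by positivity))
    have h2 : (L : ℝ) ^ 3 * g (p * L) ≤ 1 / (250 * (p : ℝ) ^ 3) * S (p * L) := by
      have h3 : (L : ℝ) ^ 3 * ((L : ℝ) ^ 3 * g (p * L)) <
          (L : ℝ) ^ 3 * (1 / (250 * (p : ℝ) ^ 3) * S (p * L)) := by
        calc (L : ℝ) ^ 3 * ((L : ℝ) ^ 3 * g (p * L)) = (L : ℝ) ^ 6 * g (p * L) := by ring
          _ < _ := h1
          _ = _ := by ring
      exact (lt_of_mul_lt_mul_left h3 (by positivity)).le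
    have h4 : 125 * ((p * L : ℕ) : ℝ) ^ 3 * g (p * L) ≤ 1 / 2 * S (p * L) := by
      calc 125 * ((p * L : ℕ) : ℝ) ^ 3 * g (p * L)
          = 125 * (p : ℝ) ^ 3 * ((L : ℝ) ^ 3 * g (p * L)) := by push_cast; ring
        _ ≤ 125 * (p : ℝ) ^ 3 * (1 / (250 * (p : ℝ) ^ 3) * S (p * L)) :=
          mul_le_mul_of_nonneg_left h2 (by positivity)
        _ = 1 / 2 * S (p * L) := by field_simp; ring
    linarith
  -- iterate along `L = 2^k L₁`
  have hiter : ∀ k : ℕ, S (p * (2 ^ k * L₁)) ≤ (3 / 2 : ℝ) ^ k * S (p * L₁) := by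
    intro k
    induction k with
    | zero => simp
    | succ k ih =>
      have hL : L₁ ≤ 2 ^ k * L₁ := Nat.le_mul_of_pos_left L₁ (pow_pos (by norm_num) k)
      have heq : p * (2 ^ (k + 1) * L₁) = 2 * (p * (2 ^ k * L₁)) := by ring
      rw [heq, pow_succ]
      calc S (2 * (p * (2 ^ k * L₁))) ≤ 3 / 2 * S (p * (2 ^ k * L₁)) := key _ hL
        _ ≤ 3 / 2 * ((3 / 2 : ℝ) ^ k * S (p * L₁)) :=
          mul_le_mul_of_nonneg_left ih (by norm_num)
        _ = (3 / 2 : ℝ) ^ k * (3 / 2) * S (p * L₁) := by ring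
  -- linear growth along the same scales
  have hgrow : ∀ k : ℕ, c * ((p : ℝ) * L₁) * (2 : ℝ) ^ k ≤ S (p * (2 ^ k * L₁)) := by
    intro k
    have h1 : 1 ≤ p * (2 ^ k * L₁) := Nat.mul_pos hp0 (Nat.mul_pos (pow_pos (by norm_num) k) hL₁1)
    have h := hlow (p * (2 ^ k * L₁)) h1
    rw [← hS] at h
    calc c * ((p : ℝ) * L₁) * (2 : ℝ) ^ k = c * ((p * (2 ^ k * L₁) : ℕ) : ℝ) := by push_cast; ring
      _ ≤ _ := h
  -- contradiction: `(4/3)^k` is bounded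
  have hA0 : 0 < c * ((p : ℝ) * L₁) := by
    have : (0 : ℝ) < L₁ := by exact_mod_cast hL₁1
    positivity
  have hfin : ∀ k : ℕ, (4 / 3 : ℝ) ^ k ≤ S (p * L₁) / (c * ((p : ℝ) * L₁)) := by
    intro k
    rw [le_div_iff₀ hA0]
    have h1 := (hgrow k).trans (hiter k)
    have h2 : (2 : ℝ) ^ k = (4 / 3 : ℝ) ^ k * (3 / 2 : ℝ) ^ k := by
      rw [← mul_pow]; norm_num
    rw [h2] at h1
    have h3 : (0 : ℝ) < (3 / 2 : ℝ) ^ k := by positivity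
    have h4 : (4 / 3 : ℝ) ^ k * (c * ((p : ℝ) * L₁)) * (3 / 2 : ℝ) ^ k ≤
        S (p * L₁) * (3 / 2 : ℝ) ^ k := by
      calc (4 / 3 : ℝ) ^ k * (c * ((p : ℝ) * L₁)) * (3 / 2 : ℝ) ^ k
          = c * ((p : ℝ) * L₁) * ((4 / 3 : ℝ) ^ k * (3 / 2 : ℝ) ^ k) := by ring
        _ ≤ (3 / 2 : ℝ) ^ k * S (p * L₁) := h1
        _ = S (p * L₁) * (3 / 2 : ℝ) ^ k := by ring
    exact le_of_mul_le_mul_right h4 h3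
  obtain ⟨n, hn⟩ := pow_unbounded_of_one_lt (S (p * L₁) / (c * ((p : ℝ) * L₁)))
    (by norm_num : (1 : ℝ) < 4 / 3)
  exact absurd (hfin n) (not_le.2 hn)

/-! ## The stub -/

/-- **S4b — block covariance versus the axial two-point function.** (1) the Messager–Miracle-Solé
`ℓ¹/ℓ^∞` sandwich `L⁶ g((j+3)L) ≤ C(L; j e₁) ≤ L⁶ g((j-1)L)` for `j ≥ 1`; (2) top-heavy scales: for
every `p ≥ 1` some `ε > 0` has `ε V(L) ≤ L⁶ g(pL)` for infinitely many `L` (shell bound against the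
infrared lower bound `⟨σ₀σ_z⟩ ≥ c‖z‖⁻²`). [cite: MessagerMiracleSoleJSP1977, main theorem (monotonicity of ⟨σ₀σ_x⟩ under reflections)] [cite: DuminilCopin2019, Exercise 37 (4), eq. (4.10), §4.3 and Thm. 4.8, §4.4] -/
theorem stub_blockCovTwoPointBounds : Sig.stub_blockCovTwoPointBounds := by
  unfold Sig.stub_blockCovTwoPointBounds
  exact ⟨fun j L hj => sandwich j L hj, fun p hp => topHeavy p hp⟩

end Summit.CriticalPhenomena.Ising3DConformalLimit.Cruxes.ExistsScaleCovariantLimit.MonotoneBlockingPort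

end
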